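import Summits.Ventures.CertifiedManyBodySolver.Downfold.EmeryBilayerAxialSplitting
import Mathlib.Analysis.Calculus.MeanValue
import HarnessLib

/-!
# THE AXIAL LEVEL IS EXPLICIT ALONG THE BAND: the resolvent form of the four-orbital secular equation, a sum-of-squares
# slope, exact monotonicity of the conduction band in the axial level, and the EXACT bilayer / c-axis splitting bracket
# `0 < Δε ≤ Δε_s`; general interlayer coupling (`t⊥_ss` and `t⊥_sp`) keeps the `w_s(k)` profile at first order

Venture CertifiedManyBodySolver, cell `pub/hubbard-downfold` (stage S1; INFLATION-RULES-3to1-B §B.80 — the `tperp/t` row of the bilayer boxes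
M257 Hg-1212, M260 Tl-2212, #33 Bi-2212, #18 YBa₂Cu₃O₇ and the c-axis (S3 interlayer) input read EXACTLY against the four-orbital
`(d, s, p_x, p_y; t_pp, t_pp′)` model), seat hubbard-downfold-mod-4 (technique B, g32); namespace `Summit.Ventures.CertifiedManyBodySolver.Downfold.Emery`.
Sequel of `EmeryBilayerAxialSplitting` (§B.79: FIRST-ORDER splitting `= 2t⊥_ss·w_s(k)` for pure `s–s` coupling) and `EmeryAxialOrbitalWeight`
(§B.78: `w_s = minor4S/dsec4`). Everything PROVED (0 sorry): `ring` identities, one `positivity`, and Mathlib's mean-value inequality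
`Convex.mul_sub_le_image_sub_of_le_deriv`. WHAT THIS IS NOT: a statement about any material; `ε_s`, `t_sp`, `t⊥_ss`, `t⊥_sp` are model inputs;
interlayer `p–p`/`d–d` hoppings and dimpling are not modelled; U = 0 one-body algebra.

* §1 THE ROOT IDENTITY AND THE EXPLICIT LEVEL. `sec4 = (ε_s − ε)·charCubic + T·axialLin` is AFFINE in the axial level, so at a root
  **`T·axialLin = (ε_s − ε)·minor4S`** (`T_mul_axialLin_of_root`), and for `minor4S ≠ 0` the axial level that puts the four-orbital band through
  the point `(k, ε)` is EXPLICIT: **`ε_s = sLevel := ε + T·axialLin/minor4S`** (`sec4_eq_zero_iff_sLevel`, `sec4_sLevel`) — the resolvent form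
  `ε_s = ε + t_sp²·⟨v|(H_σ − ε)⁻¹|v⟩` of the `s`-row Schur complement (`axialLin = vᵀadj(H_σ − ε)v`, `minor4S = det(H_σ − ε)`), written without matrices.
* §2 GENERAL INTERLAYER COUPLING. By §1, at a point of the even sheet `axialLin/W = ((ε_s + t⊥_ss − ε)/(t_sp + t⊥_sp)²)·minor4S/W` for ANY
  denominator `W` (`axialLin_div_eq_of_root`); with `EmeryBilayerAxialSplitting.sec4_odd_on_even_sheet` the first-order (Newton) step from the even sheet
  toward the odd band is **`−2·[t⊥_ss − 2t_sp t⊥_sp(ε_s + t⊥_ss − ε)/(t_sp + t⊥_sp)²]·w_s^{odd}(k)`** (`bilayer_newton_split_even_general`; from the odd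
  sheet `+2·[t⊥_ss − 2t_sp t⊥_sp(ε_s − t⊥_ss − ε)/(t_sp − t⊥_sp)²]·w_s^{even}(k)`, `bilayer_newton_split_odd_general`): THE `s–p` INTERLAYER HOPPING
  RESCALES THE AMPLITUDE AND LEAVES THE k-PROFILE `w_s(k)` UNTOUCHED — the bracket `t⊥_ss/(ε_s − ε_F) ∓ 2t⊥_sp/t_sp` of [AndersenEtAl1995, Eq. (25)]
  (their relative sign of `t_sp`, `t⊥_sp` corresponds to `t_sp·t⊥_sp < 0` in the `axialInterlayer` convention), exactly, with `(t_sp ± t⊥_sp)²` in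
  place of `t_sp²`.
* §3 THE SLOPE OF THE LEVEL MAP IS A SUM OF SQUARES. `resolventNum := daxialLin·minor4S + axialLin·∂_ε charCubic` (the numerator of
  `∂_ε(axialLin/minor4S)`, i.e. `‖adj(H_σ − ε)v‖²`) equals **`16t_pd²(Δ + ε)²(x − y)² + 4x(fsD1 − 2fsN1·y)² + 4y(fsD1 − 2fsN1·x)²`** (`resolventNum_sos`,
  `ring`), hence `≥ 0` on the zone (`resolventNum_nonneg`); `∂_ε sLevel = 1 + T·resolventNum/minor4S²` (`hasDerivAt_sLevel`) and AT A ROOT this is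
  **`dsec4/minor4S = 1/w_s`** (`dsec4_div_minor4S_of_root`: the Hellmann–Feynman slope `∂ε/∂ε_s = w_s` as the inverse-function slope; `sWeight4_of_root`: `w_s = m²/(m² + T·resolventNum)`) — so
  `0 < w_s ≤ 1` at every four-orbital band point with `minor4S ≠ 0`, `T ≥ 0` (`sWeight4_pos_of_root`, `sWeight4_le_one_of_root`), with no eigenvector.
* §4 EXACT MONOTONICITY AND THE EXACT SPLITTING BRACKET. On an energy window `[a, b]` at fixed `k` free of σ band energies (`minor4S ≠ 0`) the level
  map is increasing with slope `≥ 1`: `ε₂ − ε₁ ≤ sLevel ε₂ − sLevel ε₁` (`sub_le_sLevel_sub`, mean-value inequality). Hence for two four-orbital band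
  points `(ε₁; ε_s = ℓ₁)`, `(ε₂; ℓ₂)` at the same `k`, `T` in one window: **`ℓ₁ < ℓ₂ ⟹ ε₁ < ε₂ ∧ ε₂ − ε₁ ≤ ℓ₂ − ℓ₁`** (`root_split_bracket`): the
  conduction band is STRICTLY INCREASING in the axial level and moves by AT MOST the level shift. Bilayer, pure `s–s` (`t⊥_ss > 0`): at fixed `k`
  the odd band lies strictly below the even band and **the EXACT splitting is `≤ 2t⊥_ss`** (`bilayer_exact_split_bracket`); c-axis stack
  `ε_s(k_z) = ε_s − 2t⊥cos k_z`: the conduction band at fixed `k∥` is monotone in `−cos k_z` with total c-axis width `≤ 4t⊥` (`stack_exact_width_le`) — and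
  zero on the zone diagonal by `EmeryBilayerMirror.det_fourBandPP_sub_diag` (node blindness, exact).
* §5 (companion file `EmeryAxialResolventSecant`): the exact secant identity `(ℓ₂ − ℓ₁)·m₁m₂ = (ε₂ − ε₁)(m₁m₂ + T·resolventDD)` and the
  Hellmann–Feynman bracket as two-point convexity.

Sources: [AndersenEtAl1995, Eqs. (2), (5), (7), (24)–(25)]; [PavariniEtAl2001, Eqs. (1)–(3)]; [folklore] resolvent algebra and the mean-value inequality.
-/

noncomputable section

namespace Summit.Ventures.CertifiedManyBodySolver.Downfold.Emery

open Real Set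

/-! ## §1 The root identity and the explicit axial level -/

/-- **AT A ROOT `T·axialLin = (ε_s − ε)·minor4S`** (`sec4` is affine in the level). [cite: AndersenEtAl1995, Eqs. (2), (5)] -/
theorem T_mul_axialLin_of_root {Δ εs tpd tpp c T x y ε : ℝ} (h : sec4 Δ εs tpd tpp c T x y ε = 0) :
    T * axialLin Δ tpd tpp c x y ε = (εs - ε) * minor4S Δ tpd tpp c x y ε := by
  unfold sec4 at h; unfold minor4S; linarith

/-- `sec4 = T·axialLin − (ε_s − ε)·minor4S`. [folklore] -/
theorem sec4_eq_linear (Δ εs tpd tpp c T x y ε : ℝ) :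
    sec4 Δ εs tpd tpp c T x y ε = T * axialLin Δ tpd tpp c x y ε - (εs - ε) * minor4S Δ tpd tpp c x y ε := by
  unfold sec4 minor4S; ring

/-- THE AXIAL LEVEL THAT PUTS THE FOUR-ORBITAL BAND THROUGH `(k, ε)`: `sLevel = ε + T·axialLin/minor4S` — the resolvent form
`ε + t_sp²⟨v|(H_σ − ε)⁻¹|v⟩` of the `s`-row Schur complement. [cite: AndersenEtAl1995, Eq. (5) (energy-dependent `s` admixture)] -/
def sLevel (Δ tpd tpp c T x y ε : ℝ) : ℝ := ε + T * axialLin Δ tpd tpp c x y ε / minor4S Δ tpd tpp c x y ε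

/-- `sLevel − ε = T·axialLin/minor4S`. [folklore] -/
theorem sLevel_sub (Δ tpd tpp c T x y ε : ℝ) :
    sLevel Δ tpd tpp c T x y ε - ε = T * axialLin Δ tpd tpp c x y ε / minor4S Δ tpd tpp c x y ε := by
  unfold sLevel; ring

/-- **THE LEVEL IS EXPLICIT**: for `minor4S ≠ 0`, `sec4(ε_s; k, ε) = 0 ⟺ ε_s = sLevel(k, ε)`. [folklore] -/
theorem sec4_eq_zero_iff_sLevel {Δ tpd tpp c T x y ε : ℝ} (εs : ℝ) (hm : minor4S Δ tpd tpp c x y ε ≠ 0) :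
    sec4 Δ εs tpd tpp c T x y ε = 0 ↔ εs = sLevel Δ tpd tpp c T x y ε := by
  rw [sec4_eq_linear, sLevel]
  constructor
  · intro h
    have h2 : (εs - ε) * minor4S Δ tpd tpp c x y ε = T * axialLin Δ tpd tpp c x y ε := by linarith
    have h3 : εs - ε = T * axialLin Δ tpd tpp c x y ε / minor4S Δ tpd tpp c x y ε := by
      rw [eq_div_iff hm]; exact h2
    linarith
  · intro h
    rw [h]
    field_simp
    ring

/-- The band passes through `(k, ε)` at the level `sLevel(k, ε)`. [folklore] -/
theorem sec4_sLevel {Δ tpd tpp c T x y ε : ℝ} (hm : minor4S Δ tpd tpp c x y ε ≠ 0) :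
    sec4 Δ (sLevel Δ tpd tpp c T x y ε) tpd tpp c T x y ε = 0 :=
  (sec4_eq_zero_iff_sLevel _ hm).2 rfl

/-! ## §2 General interlayer coupling: the `s–p` hopping rescales the amplitude, the profile stays `w_s(k)` -/

/-- At a root with level `ε_s` and `T ≠ 0`: `axialLin/W = ((ε_s − ε)/T)·(minor4S/W)` for any denominator `W`. [folklore] -/
theorem axialLin_div_eq_of_root {Δ εs tpd tpp c T x y ε : ℝ} (h : sec4 Δ εs tpd tpp c T x y ε = 0) (hT : T ≠ 0) (W : ℝ) :
    axialLin Δ tpd tpp c x y ε / W = (εs - ε) / T * (minor4S Δ tpd tpp c x y ε / W) := by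
  have e := T_mul_axialLin_of_root h
  rcases eq_or_ne W 0 with hW | hW
  · simp [hW]
  · rw [div_mul_div_comm, div_eq_div_iff hW (mul_ne_zero hT hW)]
    linear_combination W * e

/-- **FROM THE EVEN SHEET, GENERAL COUPLING** (`t⊥_ss` and `t⊥_sp`; `t_sp + t⊥_sp ≠ 0`, odd energy denominator `≠ 0`): the Newton step toward the
odd band is `−2·[t⊥_ss − 2t_sp t⊥_sp (ε_s + t⊥_ss − ε)/(t_sp + t⊥_sp)²]·w_s^{odd}(k)` — the `s–p` interlayer hopping rescales the amplitude and leaves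
the profile `w_s(k)`. [cite: AndersenEtAl1995, Eqs. (7), (24)–(25)] -/
theorem bilayer_newton_split_even_general {Δ εs tpd tpp c tsp tss tspP x y ε : ℝ}
    (h : sec4 Δ (εs + tss) tpd tpp c ((tsp + tspP) ^ 2) x y ε = 0) (hT : tsp + tspP ≠ 0)
    (hW : dsec4 Δ (εs - tss) tpd tpp c ((tsp - tspP) ^ 2) x y ε ≠ 0) :
    -sec4 Δ (εs - tss) tpd tpp c ((tsp - tspP) ^ 2) x y ε / dsec4 Δ (εs - tss) tpd tpp c ((tsp - tspP) ^ 2) x y ε =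
      -2 * (tss - 2 * tsp * tspP * (εs + tss - ε) / (tsp + tspP) ^ 2) *
        sWeight4 Δ (εs - tss) tpd tpp c ((tsp - tspP) ^ 2) x y ε := by
  have e := T_mul_axialLin_of_root h
  have hT2 : (tsp + tspP) ^ 2 ≠ 0 := pow_ne_zero 2 hT
  rw [sec4_odd_on_even_sheet h]
  unfold sWeight4
  field_simp
  linear_combination (4 * tsp * tspP) * e

/-- **FROM THE ODD SHEET, GENERAL COUPLING** (`t_sp − t⊥_sp ≠ 0`): the Newton step toward the even band is
`+2·[t⊥_ss − 2t_sp t⊥_sp (ε_s − t⊥_ss − ε)/(t_sp − t⊥_sp)²]·w_s^{even}(k)`. [cite: AndersenEtAl1995, Eqs. (7), (24)–(25)] -/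
theorem bilayer_newton_split_odd_general {Δ εs tpd tpp c tsp tss tspP x y ε : ℝ}
    (h : sec4 Δ (εs - tss) tpd tpp c ((tsp - tspP) ^ 2) x y ε = 0) (hT : tsp - tspP ≠ 0)
    (hW : dsec4 Δ (εs + tss) tpd tpp c ((tsp + tspP) ^ 2) x y ε ≠ 0) :
    -sec4 Δ (εs + tss) tpd tpp c ((tsp + tspP) ^ 2) x y ε / dsec4 Δ (εs + tss) tpd tpp c ((tsp + tspP) ^ 2) x y ε =
      2 * (tss - 2 * tsp * tspP * (εs - tss - ε) / (tsp - tspP) ^ 2) *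
        sWeight4 Δ (εs + tss) tpd tpp c ((tsp + tspP) ^ 2) x y ε := by
  have e := T_mul_axialLin_of_root h
  have hT2 : (tsp - tspP) ^ 2 ≠ 0 := pow_ne_zero 2 hT
  rw [sec4_even_on_odd_sheet h]
  unfold sWeight4
  field_simp
  linear_combination (-4 * tsp * tspP) * e

/-- The general-coupling amplitude reduces to `2t⊥_ss` at `t⊥_sp = 0` (consistency with `bilayer_newton_split_even`). [folklore] -/
theorem bilayer_amplitude_pure_ss (tsp tss εs ε : ℝ) :
    tss - 2 * tsp * 0 * (εs + tss - ε) / (tsp + 0) ^ 2 = tss := by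
  simp

/-! ## §3 The slope of the level map is a sum of squares; at a root it is `1/w_s` -/

/-- The numerator of `∂_ε (axialLin/minor4S)`: `daxialLin·minor4S + axialLin·∂_ε charCubic` (`= ‖adj(H_σ − ε)v‖²`). [folklore] -/
def resolventNum (Δ tpd tpp c x y ε : ℝ) : ℝ :=
  daxialLin Δ tpp c x y ε * minor4S Δ tpd tpp c x y ε + axialLin Δ tpd tpp c x y ε * dcharCubic Δ tpd tpp c x y ε

/-- **SUM OF SQUARES**: `resolventNum = 16t_pd²(Δ + ε)²(x − y)² + 4x(fsD1 − 2fsN1·y)² + 4y(fsD1 − 2fsN1·x)²` — the three squared components of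
`adj(H_σ − ε)v` (`d`: `4t_pd(Δ + ε)(s_x² − s_y²)`; `p_x`: `2s_x(fsD1 − 2fsN1 s_y²)`; `p_y`: `2s_y(fsD1 − 2fsN1 s_x²)`). [folklore] -/
theorem resolventNum_sos (Δ tpd tpp c x y ε : ℝ) :
    resolventNum Δ tpd tpp c x y ε = 16 * tpd ^ 2 * (Δ + ε) ^ 2 * (x - y) ^ 2
      + 4 * x * (fsD1 Δ ε - 2 * fsN1 tpd tpp c ε * y) ^ 2 + 4 * y * (fsD1 Δ ε - 2 * fsN1 tpd tpp c ε * x) ^ 2 := by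
  unfold resolventNum daxialLin minor4S axialLin dcharCubic charCubic dcA dfsD dfsN fsD1 fsN1
  ring

/-- Hence `resolventNum ≥ 0` for `x, y ≥ 0` (every zone point). [folklore] -/
theorem resolventNum_nonneg {Δ tpd tpp c x y ε : ℝ} (hx : 0 ≤ x) (hy : 0 ≤ y) : 0 ≤ resolventNum Δ tpd tpp c x y ε := by
  rw [resolventNum_sos]; positivity

/-- `d minor4S/dε = −∂_ε charCubic`. [folklore] -/
theorem hasDerivAt_minor4S_eps (Δ tpd tpp c x y ε : ℝ) :
    HasDerivAt (fun e => minor4S Δ tpd tpp c x y e) (-dcharCubic Δ tpd tpp c x y ε) ε := by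
  have h : (fun e => minor4S Δ tpd tpp c x y e) = fun e => -charCubic Δ tpd tpp c x y e := by
    funext e; rfl
  rw [h]
  exact (hasDerivAt_charCubic_eps Δ tpd tpp c x y ε).neg

/-- **`∂_ε sLevel = 1 + T·resolventNum/minor4S²`** (`minor4S ≠ 0`). [folklore] -/
theorem hasDerivAt_sLevel {Δ tpd tpp c x y ε : ℝ} (T : ℝ) (hm : minor4S Δ tpd tpp c x y ε ≠ 0) :
    HasDerivAt (fun e => sLevel Δ tpd tpp c T x y e)
      (1 + T * resolventNum Δ tpd tpp c x y ε / minor4S Δ tpd tpp c x y ε ^ 2) ε := by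
  have hL := hasDerivAt_axialLin_eps Δ tpd tpp c x y ε
  have hM := hasDerivAt_minor4S_eps Δ tpd tpp c x y ε
  have hfun : (fun e => sLevel Δ tpd tpp c T x y e) =
      fun e => e + T * (axialLin Δ tpd tpp c x y e / minor4S Δ tpd tpp c x y e) := by
    funext e; unfold sLevel; ring
  rw [hfun]
  refine ((hasDerivAt_id' ε).add ((hL.div hM hm).const_mul T)).congr_deriv ?_
  unfold resolventNum
  field_simp
  ring

/-- **AT A ROOT THE SLOPE IS `dsec4/minor4S = 1/w_s`**: `dsec4/minor4S = 1 + T·resolventNum/minor4S²` when `sec4(ε_s; k, ε) = 0` — the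
Hellmann–Feynman slope `∂ε/∂ε_s = w_s` as the inverse-function slope, without eigenvectors. [folklore] -/
theorem dsec4_div_minor4S_of_root {Δ εs tpd tpp c T x y ε : ℝ} (h : sec4 Δ εs tpd tpp c T x y ε = 0)
    (hm : minor4S Δ tpd tpp c x y ε ≠ 0) :
    dsec4 Δ εs tpd tpp c T x y ε / minor4S Δ tpd tpp c x y ε =
      1 + T * resolventNum Δ tpd tpp c x y ε / minor4S Δ tpd tpp c x y ε ^ 2 := by
  have e := T_mul_axialLin_of_root h
  have hc : charCubic Δ tpd tpp c x y ε = -minor4S Δ tpd tpp c x y ε := by unfold minor4S; ring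
  unfold dsec4 resolventNum
  rw [hc]
  field_simp
  linear_combination (-dcharCubic Δ tpd tpp c x y ε) * e

/-- `1/w_s = ∂_ε sLevel` at a root, as reciprocals: `1/sWeight4 = 1 + T·resolventNum/minor4S²`. [folklore] -/
theorem inv_sWeight4_of_root {Δ εs tpd tpp c T x y ε : ℝ} (h : sec4 Δ εs tpd tpp c T x y ε = 0)
    (hm : minor4S Δ tpd tpp c x y ε ≠ 0) :
    1 / sWeight4 Δ εs tpd tpp c T x y ε = 1 + T * resolventNum Δ tpd tpp c x y ε / minor4S Δ tpd tpp c x y ε ^ 2 := by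
  rw [sWeight4, one_div_div, dsec4_div_minor4S_of_root h hm]

/-- At a root with `T ≥ 0` on the zone: `dsec4/minor4S ≥ 1`. [folklore] -/
theorem one_le_dsec4_div_minor4S_of_root {Δ εs tpd tpp c T x y ε : ℝ} (h : sec4 Δ εs tpd tpp c T x y ε = 0)
    (hm : minor4S Δ tpd tpp c x y ε ≠ 0) (hT : 0 ≤ T) (hx : 0 ≤ x) (hy : 0 ≤ y) :
    1 ≤ dsec4 Δ εs tpd tpp c T x y ε / minor4S Δ tpd tpp c x y ε := by
  rw [dsec4_div_minor4S_of_root h hm]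
  have : 0 ≤ T * resolventNum Δ tpd tpp c x y ε / minor4S Δ tpd tpp c x y ε ^ 2 :=
    div_nonneg (mul_nonneg hT (resolventNum_nonneg hx hy)) (sq_nonneg _)
  linarith

/-- **`0 < w_s` at every four-orbital band point** with `minor4S ≠ 0`, `T ≥ 0` on the zone. [folklore] -/
theorem sWeight4_pos_of_root {Δ εs tpd tpp c T x y ε : ℝ} (h : sec4 Δ εs tpd tpp c T x y ε = 0)
    (hm : minor4S Δ tpd tpp c x y ε ≠ 0) (hT : 0 ≤ T) (hx : 0 ≤ x) (hy : 0 ≤ y) :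
    0 < sWeight4 Δ εs tpd tpp c T x y ε := by
  have h1 := one_le_dsec4_div_minor4S_of_root h hm hT hx hy
  rw [sWeight4, ← one_div_div]
  exact div_pos one_pos (by linarith)

/-- **`w_s ≤ 1` at every four-orbital band point** with `minor4S ≠ 0`, `T ≥ 0` on the zone — no eigenvector normalisation used. [folklore] -/
theorem sWeight4_le_one_of_root {Δ εs tpd tpp c T x y ε : ℝ} (h : sec4 Δ εs tpd tpp c T x y ε = 0)
    (hm : minor4S Δ tpd tpp c x y ε ≠ 0) (hT : 0 ≤ T) (hx : 0 ≤ x) (hy : 0 ≤ y) :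
    sWeight4 Δ εs tpd tpp c T x y ε ≤ 1 := by
  have h1 := one_le_dsec4_div_minor4S_of_root h hm hT hx hy
  rw [sWeight4, ← one_div_div]
  exact div_le_one_of_le₀ h1 (by linarith)

/-! ## §4 Exact monotonicity of the band in the axial level; the exact splitting bracket -/

/-- **THE LEVEL MAP HAS SLOPE `≥ 1` ON A BAND WINDOW**: on `[a, b]` at fixed `k` with `minor4S ≠ 0` throughout (no σ band energy inside), `T ≥ 0`,
`x, y ≥ 0`: `ε₂ − ε₁ ≤ sLevel ε₂ − sLevel ε₁` for `ε₁ ≤ ε₂` (mean-value inequality). [folklore] -/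
theorem sub_le_sLevel_sub {Δ tpd tpp c T x y a b : ℝ} (hT : 0 ≤ T) (hx : 0 ≤ x) (hy : 0 ≤ y)
    (hm : ∀ e ∈ Icc a b, minor4S Δ tpd tpp c x y e ≠ 0) {ε₁ ε₂ : ℝ} (h₁ : ε₁ ∈ Icc a b) (h₂ : ε₂ ∈ Icc a b)
    (hle : ε₁ ≤ ε₂) :
    ε₂ - ε₁ ≤ sLevel Δ tpd tpp c T x y ε₂ - sLevel Δ tpd tpp c T x y ε₁ := by
  have hder : ∀ e ∈ Icc a b, HasDerivAt (fun e => sLevel Δ tpd tpp c T x y e)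
      (1 + T * resolventNum Δ tpd tpp c x y e / minor4S Δ tpd tpp c x y e ^ 2) e :=
    fun e he => hasDerivAt_sLevel T (hm e he)
  have hcont : ContinuousOn (fun e => sLevel Δ tpd tpp c T x y e) (Icc a b) :=
    fun e he => (hder e he).continuousAt.continuousWithinAt
  have hdiff : DifferentiableOn ℝ (fun e => sLevel Δ tpd tpp c T x y e) (interior (Icc a b)) :=
    fun e he => (hder e (interior_subset he)).differentiableAt.differentiableWithinAt
  have hge : ∀ e ∈ interior (Icc a b), (1 : ℝ) ≤ deriv (fun e => sLevel Δ tpd tpp c T x y e) e := by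
    intro e he
    rw [(hder e (interior_subset he)).deriv]
    have : 0 ≤ T * resolventNum Δ tpd tpp c x y e / minor4S Δ tpd tpp c x y e ^ 2 :=
      div_nonneg (mul_nonneg hT (resolventNum_nonneg hx hy)) (sq_nonneg _)
    linarith
  have h := (convex_Icc a b).mul_sub_le_image_sub_of_le_deriv hcont hdiff hge ε₁ h₁ ε₂ h₂ hle
  simpa using h

/-- The level map is strictly increasing on a band window. [folklore] -/
theorem sLevel_strictMonoOn {Δ tpd tpp c T x y a b : ℝ} (hT : 0 ≤ T) (hx : 0 ≤ x) (hy : 0 ≤ y)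
    (hm : ∀ e ∈ Icc a b, minor4S Δ tpd tpp c x y e ≠ 0) :
    StrictMonoOn (fun e => sLevel Δ tpd tpp c T x y e) (Icc a b) := by
  intro ε₁ h₁ ε₂ h₂ hlt
  have := sub_le_sLevel_sub hT hx hy hm h₁ h₂ hlt.le
  simp only
  linarith

/-- **THE EXACT SPLITTING BRACKET**: two four-orbital band points `(ε₁; level ℓ₁)`, `(ε₂; level ℓ₂)` at the same `k`, `T ≥ 0` in one band window
`[a, b]` (`minor4S ≠ 0` on it; `x, y ≥ 0`) with `ℓ₁ < ℓ₂` satisfy **`ε₁ < ε₂` and `ε₂ − ε₁ ≤ ℓ₂ − ℓ₁`** — the band is strictly increasing in the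
axial level and moves by at most the level shift (all orders). [folklore] -/
theorem root_split_bracket {Δ tpd tpp c T x y a b ℓ₁ ℓ₂ ε₁ ε₂ : ℝ} (hT : 0 ≤ T) (hx : 0 ≤ x) (hy : 0 ≤ y)
    (hm : ∀ e ∈ Icc a b, minor4S Δ tpd tpp c x y e ≠ 0) (h₁ : ε₁ ∈ Icc a b) (h₂ : ε₂ ∈ Icc a b)
    (r₁ : sec4 Δ ℓ₁ tpd tpp c T x y ε₁ = 0) (r₂ : sec4 Δ ℓ₂ tpd tpp c T x y ε₂ = 0) (hℓ : ℓ₁ < ℓ₂) :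
    ε₁ < ε₂ ∧ ε₂ - ε₁ ≤ ℓ₂ - ℓ₁ := by
  have e₁ := (sec4_eq_zero_iff_sLevel ℓ₁ (hm _ h₁)).1 r₁
  have e₂ := (sec4_eq_zero_iff_sLevel ℓ₂ (hm _ h₂)).1 r₂
  rcases lt_or_ge ε₁ ε₂ with hlt | hge
  · refine ⟨hlt, ?_⟩
    have := sub_le_sLevel_sub hT hx hy hm h₁ h₂ hlt.le
    rw [← e₁, ← e₂] at this
    exact this
  · exfalso
    have := sub_le_sLevel_sub hT hx hy hm h₂ h₁ hge
    rw [← e₁, ← e₂] at this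
    linarith

/-- **BILAYER, PURE `s–s` COUPLING, EXACTLY** (`t⊥_ss > 0`, `t_sp² ≥ 0` automatic): if the even band (level `ε_s + t⊥_ss`) passes through
`(k, ε_e)` and the odd band (level `ε_s − t⊥_ss`) through `(k, ε_o)`, both energies in one band window at that `k`, then `ε_o < ε_e` and the EXACT
splitting is at most `2t⊥_ss`. [cite: AndersenEtAl1995, Eq. (24)] -/
theorem bilayer_exact_split_bracket {Δ εs tpd tpp c tsp tss x y a b εe εo : ℝ} (htss : 0 < tss) (hx : 0 ≤ x) (hy : 0 ≤ y)
    (hm : ∀ e ∈ Icc a b, minor4S Δ tpd tpp c x y e ≠ 0) (he : εe ∈ Icc a b) (ho : εo ∈ Icc a b)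
    (re : sec4 Δ (εs + tss) tpd tpp c (tsp ^ 2) x y εe = 0) (ro : sec4 Δ (εs - tss) tpd tpp c (tsp ^ 2) x y εo = 0) :
    εo < εe ∧ εe - εo ≤ 2 * tss := by
  have h := root_split_bracket (sq_nonneg tsp) hx hy hm ho he ro re (by linarith)
  exact ⟨h.1, by linarith [h.2]⟩

/-- **c-AXIS STACK, EXACTLY**: with the stacked axial level `ε_s − 2t⊥cos(k_z)` (`t⊥ > 0`), two `k_z` values whose conduction-band energies at the
same `k∥` lie in one band window are ordered like `−cos k_z` and differ by at most `2t⊥·|cos k_z − cos k_z′| ≤ 4t⊥`: the EXACT c-axis width of the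
`CuO₂` band at fixed `k∥` is `≤ 4t⊥` (and zero on the zone diagonal, `EmeryBilayerMirror.det_fourBandPP_sub_diag`).
[cite: AndersenEtAl1995, §8 (inter-plane hopping via Cu 4s)] -/
theorem stack_exact_width_le {Δ εs tpd tpp c tsp tperp x y a b kz kz' ε ε' : ℝ} (ht : 0 < tperp) (hx : 0 ≤ x) (hy : 0 ≤ y)
    (hm : ∀ e ∈ Icc a b, minor4S Δ tpd tpp c x y e ≠ 0) (he : ε ∈ Icc a b) (he' : ε' ∈ Icc a b)
    (r : sec4 Δ (εs - 2 * tperp * Real.cos kz) tpd tpp c (tsp ^ 2) x y ε = 0)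
    (r' : sec4 Δ (εs - 2 * tperp * Real.cos kz') tpd tpp c (tsp ^ 2) x y ε' = 0)
    (hcos : Real.cos kz' < Real.cos kz) :
    ε < ε' ∧ ε' - ε ≤ 2 * tperp * (Real.cos kz - Real.cos kz') ∧ ε' - ε ≤ 4 * tperp := by
  have hℓ : εs - 2 * tperp * Real.cos kz < εs - 2 * tperp * Real.cos kz' := by nlinarith
  have h := root_split_bracket (sq_nonneg tsp) hx hy hm he he' r r' hℓ
  refine ⟨h.1, by linarith [h.2], ?_⟩
  have hc1 := Real.cos_le_one kz
  have hc2 := Real.neg_one_le_cos kz'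
  nlinarith [h.2]

end Summit.Ventures.CertifiedManyBodySolver.Downfold.Emery
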